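import Literature.MathematicalPhysics.QuantumFieldTheory.Balaban1983to89.B9Eq3104CutoffCommutators
import Literature.MathematicalPhysics.QuantumFieldTheory.Balaban1983to89.B9Thm37CommutatorBound389
import Literature.MathematicalPhysics.QuantumFieldTheory.Balaban1983to89.B6CutoffSupportKLevelV1
import Literature.MathematicalPhysics.QuantumFieldTheory.Balaban1983to89.B9Eq3132Ineq2142Covariant

/-!
# `Balaban1983to89.B9Eq3104CutoffCommutatorSizes` — T. Bałaban, *Propagators for lattice gauge theories in a background field*,
# Commun. Math. Phys. **99** (1985) 389–434 [Balaban1985BackgroundPropagators], Sect. C p. 414: «the commutators [D*D, h] and [DD*, h] are first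
# order differential operators with coefficients determined by derivatives of the function h. They are of the order O(M⁻¹), or O(M⁻²), if considered
# on a proper scale» — THE PRINT-SHAPE SIZES OF THE COEFFICIENT KERNELS of this seat's `B9Eq3104CutoffCommutators` AT THE CUT-OFFS OF RECORD `h_□ = hTY i □`:
# for the DIFFERENTIAL letters `D_U`, `D*_U`, curl, co-curl (one lattice step: `|h_□(b₋) − h_□(z)| ≤ C1F∕(8S_j∕5) = (5∕8)C1F∕(L·M_h)·L^{−j}`) and the BLOCK
# averagings `Q′(U)`, `Q′*(U)` (same block of `𝔅`: `≤ sLipT∕(L·M_h)`) and the BOND averagings `Q(U)`, `Q*(U)` (double block: `≤ sLipT∕(L·M_h)·(L+3)`)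
# (sub-row G-B9-LETTERS, module M5.7, combinatorial half, file B′)

statement-level skeleton of published theorems with citation tags; proofs where landed; nothing here is a claim about the Yang–Mills mass gap

[4] = [Balaban1984PropagatorsII] p. 247: «|∂h_□| ≤ O(1)(MLʲη)⁻¹», whose typed form at the cover of record is this seat's gen-26
`B6Partition118KLevelTorusBinders.abs_hT_sub_le_near` ∕ `abs_hT_sub_le_distT`, read on def-Y's carrier in `B9Thm37CubeCoverCommutatorSizes`
(`abs_hTY_shiftY_sub_le`, `C1F_div_bigSide_eq`).

## WHAT THIS FILE PROVES (THEOREMS only; 0 `def … : Prop`, 0 sorry)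
* §1 kernel supports of def-Y's flat kernels read for cut-offs: `gradK_ne_zero_imp` (z = chart b₋ or chart b₊ = `shiftY b.dir (chart b₋)`), `abs_gradK_le`
  (`≤ |c_f|`), `curlK_ne_zero_imp` (b one of the four contour bonds, so `b₋ ∈ {p₋, p₋+e_μ, p₋+e_ν}`), `qpK_ne_zero_imp` ∕ `qpsK_ne_zero_imp` (`Δ(z) = s`).
* §2 ★ PROFILE INCREMENTS OF `h_□` ON THOSE SUPPORTS: `abs_hBdY_sub_le_of_gradK_ne_zero`, `abs_sub_hBdY_le_of_divK_ne_zero`, `abs_hPlY_sub_hBdY_le_of_curlK_ne_zero`,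
  `abs_hBdY_sub_hPlY_le_of_cocurlK_ne_zero` (all `≤ C1F∕(8S_j∕5)`), `abs_hBkY_sub_le_of_qpK_ne_zero`, `abs_sub_hBkY_le_of_qpsK_ne_zero` (`≤ sLipT∕(L·M_h)`),
  ★ `abs_hIbY_sub_hBdY_le_of_qK_ne_zero`, `abs_hBdY_sub_hIbY_le_of_qsK_ne_zero` (bond averaging across the double block: `≤ sLipT∕(L·M_h)·(L+3)`).
* §3 ★★ (3.100) AS ONE TERM and its size: `cutCommR_gradY_apply` — `([h]D_U Λ)(b) = (c_f(h(b₋) − h(b₊)))•R(U(b))Λ(chart b₊)` EXACTLY (print's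
  `(∂_μh)(x)R(U(x,x+ηe_μ))A_ν(x+ηe_μ)` with the sign of `[h]· = h· − ·h`), `norm_cutCommR_gradY_hTY_apply_le` (`≤ |c_f|·C1F∕(8S_j∕5)·‖Λ(chart b₊)‖` at a
  bi-contraction `U(b)`); the sizes of the extra terms of `cdB_cutMulY_apply` ∕ `cdsB_cutMulY_apply`: `norm_cdB_cutMulY_sub_le`, `norm_cdsB_cutMulY_sub_le`.
* §4 the generic sizes of file A′ specialised: `norm_cutCommR_curlY_hTY_apply_le`, `norm_cutCommR_QpY_hTY_apply_le`, `norm_cutCommR_QY_hTY_apply_le`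
  (θ·B·Σ|kernel| with the θ of §2).
HONEST SCOPE.  The bond-averaging increment is stated with the factor `(L + 3)` of the double block's reach (r03's `metBlocks` bound, [4] (2.45)) — print's
«O(M⁻¹)» with an `L`-dependent constant, uniform in `j` and `η`; no kernel row-mass counts beyond the gradient's single entry; nothing of Thm 3.10 ∕ 3.3 asserted; YM mass gap NOT proved by any of this (Track A conditional rung).  `--supports stmt-QuantumFields-19200`.  Net new unproved facts: 0.
-/

noncomputable section

namespace Literature.MathematicalPhysics.QuantumFieldTheory.Balaban1983to89.B9Eq3104CutoffCommutatorSizes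

open Node00
open B9Thm37CubeCoverCommutators (cutMulY cutMulY_apply hTY hTY_apply)
open B9Thm37CubeCoverCommutatorSizes (side_conditions abs_hTY_shiftY_sub_le abs_hTY_shiftY_symm_sub_le)
open B9Eq3104CutoffCommutators
open B6KLevelCensusIndexV1 (KIdx)
open B6Ineq2142KLevelV1 (β qwt metBlocks)
open B6CutoffSupportKLevelV1 (blkV1_mem_metBlocks dist_beta_le_of_mem_metBlocks)
open B6GlobalChartV1 (PV)
open Node00.OpsYNablaBridge (chartY shiftY_chartY shiftY_symm_chartY gradK_apply_of_ne gradK_apply_tgt gradK_apply_src divK_apply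
  gradT_apply_tgt)
open B6MultiLevelBoxOperator (bigSide)
open B6Geom246MultiLevelBox (bset blkOf blkOf_corner)
open B6Geom246MultiLevelTorus (bondT)
open B6Cover236MultiLevelBlocks (cubes)
open B6Partition118KLevelTorus (hT)
open B6Partition118KLevelFineSizes (C1F C1F_nonneg)
open B6Partition118KLevelTorusBinders (sLipT sLipT_nonneg abs_hT_sub_le_distT)
open B6Ineq288MultiLevelTorus (QM QsM)
open B9BackgroundsKLevelV1 (shiftsV1)
open B9Eq39Adjoint (R R_smul)
open scoped Matrix

variable {𝔸 : Type} [NormedRing 𝔸] [NormedAlgebra ℂ 𝔸] [CompleteSpace 𝔸]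
variable {d ℓ : ℕ} {hd : 1 ≤ d + 1} {hL : Odd (ℓ + 1) ∧ 1 < ℓ + 1} {b₀ b₁ : ℝ}
variable (i : KIdx d ℓ hd hL b₀ b₁)

/-! ## §1 Supports of the flat kernels, read for cut-offs -/

/-- `chart b₊ = shiftY_{b.dir}(chart b₋)`. [cite: Balaban1985BackgroundPropagators, (3.3) p.390, dictionary] -/
theorem chart_tgt_eq_shiftY (b : FBondY i) : chartY i b.tgt = shiftY i b.dir (chartY i b.src) := by
  rw [PBond.tgt, ← shiftY_chartY]

/-- the gradient kernel's support: `∂(b, z) ≠ 0 ⟹ z = chart b₋ ∨ z = chart b₊`. [cite: Balaban1985BackgroundPropagators, (3.3) p.390, bookkeeping] -/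
theorem gradK_ne_zero_imp {b : FBondY i} {z : SiteY i} (h : gradK i b z ≠ 0) : z = chartY i b.src ∨ z = chartY i b.tgt := by
  by_contra hc
  push Not at hc
  exact h (gradK_apply_of_ne i hc.2 hc.1)

/-- the gradient kernel's entries are `0, ±c_f`: `|∂(b, z)| ≤ |c_f|`. [cite: Balaban1985BackgroundPropagators, (3.3) p.390, bookkeeping] -/
theorem abs_gradK_le (b : FBondY i) (z : SiteY i) : |gradK i b z| ≤ |i.cf| := by
  by_cases h1 : z = chartY i b.tgt
  · rw [h1]; exact (congrArg _ (gradK_apply_tgt i b)).le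
  · by_cases h0 : z = chartY i b.src
    · rw [h0, gradK_apply_src i b, abs_neg]
    · rw [gradK_apply_of_ne i h1 h0, abs_zero]; exact abs_nonneg _

/-- the curl kernel's support: `∂(p, b) ≠ 0 ⟹ b` is one of the four contour bonds of `p`. [cite: Balaban1985BackgroundPropagators, (3.4) p.391, bookkeeping] -/
theorem curlK_ne_zero_imp {p : PlaqY i} {b : FBondY i} (h : curlK i p b ≠ 0) :
    b = ⟨p.src, p.μ⟩ ∨ b = ⟨p.src.shift p.μ, p.ν⟩ ∨ b = ⟨p.src.shift p.ν, p.μ⟩ ∨ b = ⟨p.src, p.ν⟩ := by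
  by_contra hc
  push Not at hc
  obtain ⟨h1, h2, h3, h4⟩ := hc
  apply h
  show LinearMap.toMatrix' (B6Ineq2133TwoScaleV1.onFun (B6SectAOperatorsV1.dcE (P := PV d ℓ i.m i.K hd hL) i.cf)) p b = 0
  rw [B6AgreeLapV1Chart.toMatrix'_dcE, if_neg (Ne.symm h1), if_neg (Ne.symm h2), if_neg (Ne.symm h3), if_neg (Ne.symm h4)]
  ring

/-- hence the contour bond's initial point is `p₋`, `p₋ + e_μ` or `p₋ + e_ν`. [cite: Balaban1985BackgroundPropagators, (3.4) p.391, bookkeeping] -/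
theorem src_of_curlK_ne_zero {p : PlaqY i} {b : FBondY i} (h : curlK i p b ≠ 0) :
    b.src = p.src ∨ b.src = p.src.shift p.μ ∨ b.src = p.src.shift p.ν := by
  rcases curlK_ne_zero_imp i h with h | h | h | h <;> subst h <;> simp

/-- the block-averaging kernel's support: `Q′(s, z) ≠ 0 ⟹ Δ(z) = s`. [cite: Balaban1985BackgroundPropagators, (3.21) p.394, bookkeeping] -/
theorem qpK_ne_zero_imp {s : BlkY i} {z : SiteY i} (h : qpK i s z ≠ 0) : blkOf i.D.toDomains z = s := by
  rw [qpK_eq] at h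
  by_contra hc
  exact h (by unfold QM; rw [if_neg hc])

/-- and of its adjoint: `Q′*(z, s) ≠ 0 ⟹ Δ(z) = s`. [cite: Balaban1985BackgroundPropagators, (3.24) p.395, bookkeeping] -/
theorem qpsK_ne_zero_imp {z : SiteY i} {s : BlkY i} (h : qpsK i z s ≠ 0) : blkOf i.D.toDomains z = s := by
  rw [qpsK_eq] at h
  by_contra hc
  exact h (by unfold QsM; rw [if_neg hc])

/-! ## §2 Profile increments of the cut-offs of record on those supports -/

/-- ★ **ONE LATTICE STEP ALONG A BOND**: `∂(b, z) ≠ 0 ⟹ |h_□(b₋) − h_□(z)| ≤ C1F∕(8S_j∕5)` ([4] «|∂h_□| ≤ O(1)(MLʲη)⁻¹»).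
[cite: Balaban1984PropagatorsII, p.247; Balaban1985BackgroundPropagators, (3.100) p.413] -/
theorem abs_hBdY_sub_le_of_gradK_ne_zero (c : ↥(cubes i.D.toDomains)) {b : FBondY i} {z : SiteY i} (h : gradK i b z ≠ 0) :
    |hBdY i (hTY i c) b - hTY i c z| ≤ C1F d ℓ / (8 / 5 * (bigSide ℓ i.Mh c.1.1 : ℝ)) := by
  have hC : 0 ≤ C1F d ℓ / (8 / 5 * (bigSide ℓ i.Mh c.1.1 : ℝ)) := div_nonneg (C1F_nonneg d ℓ) (by positivity)
  rcases gradK_ne_zero_imp i h with hz | hz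
  · rw [hz, hBdY_apply, sub_self, abs_zero]; exact hC
  · rw [hz, hBdY_apply, chart_tgt_eq_shiftY, abs_sub_comm]
    exact abs_hTY_shiftY_sub_le i c b.dir _

/-- the same for the divergence kernel (transposed support). [cite: Balaban1984PropagatorsII, p.247; Balaban1985BackgroundPropagators, (3.8) p.392, (3.100) p.413] -/
theorem abs_sub_hBdY_le_of_divK_ne_zero (c : ↥(cubes i.D.toDomains)) {z : SiteY i} {b : FBondY i} (h : divK i z b ≠ 0) :
    |hTY i c z - hBdY i (hTY i c) b| ≤ C1F d ℓ / (8 / 5 * (bigSide ℓ i.Mh c.1.1 : ℝ)) := by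
  rw [divK_apply] at h
  rw [abs_sub_comm]
  exact abs_hBdY_sub_le_of_gradK_ne_zero i c h

/-- ★ **ONE LATTICE STEP AROUND A PLAQUETTE**: `∂(p, b) ≠ 0 ⟹ |h_□(p₋) − h_□(b₋)| ≤ C1F∕(8S_j∕5)`.
[cite: Balaban1984PropagatorsII, p.247; Balaban1985BackgroundPropagators, (3.4) p.391, (3.100) p.413] -/
theorem abs_hPlY_sub_hBdY_le_of_curlK_ne_zero (c : ↥(cubes i.D.toDomains)) {p : PlaqY i} {b : FBondY i} (h : curlK i p b ≠ 0) :
    |hPlY i (hTY i c) p - hBdY i (hTY i c) b| ≤ C1F d ℓ / (8 / 5 * (bigSide ℓ i.Mh c.1.1 : ℝ)) := by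
  have hC : 0 ≤ C1F d ℓ / (8 / 5 * (bigSide ℓ i.Mh c.1.1 : ℝ)) := div_nonneg (C1F_nonneg d ℓ) (by positivity)
  rw [hPlY_apply, hBdY_apply]
  rcases src_of_curlK_ne_zero i h with hs | hs | hs
  · rw [hs, sub_self, abs_zero]; exact hC
  · rw [hs, ← shiftY_chartY, abs_sub_comm]; exact abs_hTY_shiftY_sub_le i c p.μ _
  · rw [hs, ← shiftY_chartY, abs_sub_comm]; exact abs_hTY_shiftY_sub_le i c p.ν _

/-- the same for the co-curl kernel (transposed support). [cite: Balaban1984PropagatorsII, p.247; Balaban1985BackgroundPropagators, (3.9) p.392] -/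
theorem abs_hBdY_sub_hPlY_le_of_cocurlK_ne_zero (c : ↥(cubes i.D.toDomains)) {b : FBondY i} {p : PlaqY i} (h : cocurlK i b p ≠ 0) :
    |hBdY i (hTY i c) b - hPlY i (hTY i c) p| ≤ C1F d ℓ / (8 / 5 * (bigSide ℓ i.Mh c.1.1 : ℝ)) := by
  rw [cocurlK_eq_transpose, Matrix.transpose_apply] at h
  rw [abs_sub_comm]
  exact abs_hPlY_sub_hBdY_le_of_curlK_ne_zero i c h

/-- ★ **WITHIN ONE BLOCK OF `𝔅`**: `Q′(s, z) ≠ 0 ⟹ |h_□(corner s) − h_□(z)| ≤ sLipT∕(L·M_h)` ([4] «h_□′(x′) − h_□′(x) can be estimated by O(1)M⁻¹d(y,y′)»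
at `d = 0`). [cite: Balaban1984PropagatorsII, p.247; Balaban1985BackgroundPropagators, (3.21) p.394, (3.102) p.414] -/
theorem abs_hBkY_sub_le_of_qpK_ne_zero (c : ↥(cubes i.D.toDomains)) {s : BlkY i} {z : SiteY i} (h : qpK i s z ≠ 0) :
    |hBkY i (hTY i c) s - hTY i c z| ≤ sLipT d ℓ / (((ℓ : ℝ) + 1) * i.Mh) := by
  obtain ⟨hℓ, hMh, hR, hP5⟩ := side_conditions i
  have hz := qpK_ne_zero_imp i h
  have e := abs_hT_sub_le_distT (D := i.D) hℓ hMh hR hP5 c z (blkCornerY i s)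
  rw [hz, show blkOf i.D.toDomains (blkCornerY i s) = s from blkOf_corner i.D.toDomains s, SimpleGraph.dist_self, Nat.cast_zero, zero_add,
    mul_one] at e
  exact e

/-- and for `Q′*`. [cite: Balaban1984PropagatorsII, p.247; Balaban1985BackgroundPropagators, (3.24) p.395] -/
theorem abs_sub_hBkY_le_of_qpsK_ne_zero (c : ↥(cubes i.D.toDomains)) {z : SiteY i} {s : BlkY i} (h : qpsK i z s ≠ 0) :
    |hTY i c z - hBkY i (hTY i c) s| ≤ sLipT d ℓ / (((ℓ : ℝ) + 1) * i.Mh) := by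
  obtain ⟨hℓ, hMh, hR, hP5⟩ := side_conditions i
  have hz := qpsK_ne_zero_imp i h
  have e := abs_hT_sub_le_distT (D := i.D) hℓ hMh hR hP5 c (blkCornerY i s) z
  rw [hz, show blkOf i.D.toDomains (blkCornerY i s) = s from blkOf_corner i.D.toDomains s, SimpleGraph.dist_self, Nat.cast_zero, zero_add,
    mul_one] at e
  exact e

/-- `K ≥ 1`-type side facts of a member for r03's double-block lemmas: `1 ≤ k`, `2 ≤ R·M_h`, `1 ≤ M_h`, `P′_μ ≥ 1`.
[cite: Balaban1984PropagatorsII, (2.1)–(2.2) p.224, bookkeeping] -/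
theorem side_conditions' : 1 ≤ i.k ∧ 2 ≤ i.R * i.Mh ∧ 1 ≤ i.Mh ∧ ∀ μ, 1 ≤ i.P' μ := by
  obtain ⟨hℓ, hMh, hR, hP5⟩ := side_conditions i
  refine ⟨le_trans one_le_two i.hk2, ?_, le_trans one_le_two hMh, fun μ => le_trans (by norm_num) (hP5 μ)⟩
  calc 2 ≤ 2 * (ℓ + 1) := by omega
    _ ≤ i.R := hR
    _ = i.R * 1 := (mul_one _).symm
    _ ≤ i.R * i.Mh := Nat.mul_le_mul_left _ (le_trans one_le_two hMh)

/-- ★ **ACROSS THE DOUBLE BLOCK OF A COARSE BOND**: `Q(c, f) ≠ 0 ⟹ |h_□(corner β(c)) − h_□(f₋)| ≤ sLipT∕(L·M_h)·(L + 3)` — the fine bonds averaged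
by `Q(U)` at `c` issue from the double block `Bʲ(c₋) ∪ Bʲ(c₊)`, whose blocks of `𝔅` are within torus block distance `L + 2` of the carrier block
(r03 ∕ p21: `blkV1_mem_metBlocks`, `dist_beta_le_of_mem_metBlocks`), and `h_□` varies by `≤ sLipT∕M·(d_T + 1)` ([4] p.247).
[cite: Balaban1984PropagatorsII, (2.45) p.231, p.247; Balaban1985BackgroundPropagators, (3.102) p.414] -/
theorem abs_hIbY_sub_hBdY_le_of_qK_ne_zero (c : ↥(cubes i.D.toDomains)) {y : IBondY i} {f : FBondY i} (h : qK i y f ≠ 0) :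
    |hIbY i (hTY i c) y - hBdY i (hTY i c) f| ≤ sLipT d ℓ / (((ℓ : ℝ) + 1) * i.Mh) * (((ℓ : ℝ) + 1) + 3) := by
  obtain ⟨hℓ, hMh, hR, hP5⟩ := side_conditions i
  obtain ⟨hk1, hRM, hMh1, hP1⟩ := side_conditions' i
  have hq : qwt i.hN i.D i.hk y f ≠ 0 := by rwa [B9Eq3132Ineq2142Covariant.qK_apply] at h
  have hmem : blkOf i.D.toDomains (chartY i f.src) ∈ metBlocks i.hN i.D i.hk y := blkV1_mem_metBlocks i.hN i.D i.hk y hq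
  have hdist : ((bondT i.D).dist (β i.hN i.D i.hk y) (blkOf i.D.toDomains (chartY i f.src)) : ℝ) ≤ (ℓ : ℝ) + 3 :=
    dist_beta_le_of_mem_metBlocks i.hN i.D i.hk hk1 hRM hMh1 hP1 y hmem
  have e := abs_hT_sub_le_distT (D := i.D) hℓ hMh hR hP5 c (chartY i f.src) (blkCornerY i (β i.hN i.D i.hk y))
  rw [show blkOf i.D.toDomains (blkCornerY i (β i.hN i.D i.hk y)) = β i.hN i.D i.hk y from blkOf_corner i.D.toDomains _,
    SimpleGraph.dist_comm] at e
  have hθ : 0 ≤ sLipT d ℓ / (((ℓ : ℝ) + 1) * i.Mh) := div_nonneg (sLipT_nonneg d ℓ) (by positivity)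
  calc |hIbY i (hTY i c) y - hBdY i (hTY i c) f| = |hT i.D c (blkCornerY i (β i.hN i.D i.hk y)) - hT i.D c (chartY i f.src)| := rfl
    _ ≤ _ := e
    _ ≤ sLipT d ℓ / (((ℓ : ℝ) + 1) * i.Mh) * (((ℓ : ℝ) + 1) + 3) := mul_le_mul_of_nonneg_left (by linarith) hθ

/-- and for `Q*(U)` (transposed kernel `qsK = qKᵀ`). [cite: Balaban1984PropagatorsII, (2.45) p.231, p.247; Balaban1985BackgroundPropagators, (3.103) p.414] -/
theorem abs_hBdY_sub_hIbY_le_of_qsK_ne_zero (c : ↥(cubes i.D.toDomains)) {f : FBondY i} {y : IBondY i} (h : qsK i f y ≠ 0) :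
    |hBdY i (hTY i c) f - hIbY i (hTY i c) y| ≤ sLipT d ℓ / (((ℓ : ℝ) + 1) * i.Mh) * (((ℓ : ℝ) + 1) + 3) := by
  rw [qsK_eq_transpose, Matrix.transpose_apply] at h
  rw [abs_sub_comm]
  exact abs_hIbY_sub_hBdY_le_of_qK_ne_zero i c h

/-! ## §3 (3.100) as one term, and the sizes of the first-order terms -/

/-- ★★ **(3.100) AT THE OPERATOR LEVEL, EXACTLY ONE TERM**: `([h]D_U Λ)(b) = (c_f(h(b₋) − h(b₊)))•R(U(b))Λ(chart b₊)` — print's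
`(∂_μh)(x)R(U(x, x+ηe_μ))A_ν(x+ηe_μ)` (sign of `[h]· = h· − ·h`; the `b₋`-leg carries `h(b₋) − h(b₋) = 0`). [cite: Balaban1985BackgroundPropagators, (3.100) p.413] -/
theorem cutCommR_gradY_apply (h : SiteY i → ℝ) (U : CfgY 𝔸 i) (Λ : SiteY i → 𝔸) (b : FBondY i) :
    cutCommR (hBdY i h) h (gradY i U) Λ b
      = ((i.cf * (h (chartY i b.src) - h (chartY i b.tgt)) : ℝ) : ℂ) • R (U b.dir b.src) (Λ (chartY i b.tgt)) := by
  classical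
  rw [cutCommR_gradY, trLiftY_apply]
  rw [Finset.sum_eq_single (chartY i b.tgt)]
  · rw [Matrix.of_apply, hBdY_apply]
    have e1 : gradK i b (chartY i b.tgt) = i.cf := gradK_apply_tgt i b
    have e2 : gradT i U b (chartY i b.tgt) = U b.dir b.src := gradT_apply_tgt i U b
    rw [e1, e2]
  · intro z _ hz
    rw [Matrix.of_apply]
    by_cases h0 : z = chartY i b.src
    · rw [h0, hBdY_apply, sub_self, mul_zero, Complex.ofReal_zero, zero_smul]
    · rw [gradK_apply_of_ne i hz h0, zero_mul, Complex.ofReal_zero, zero_smul]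
  · intro hb; exact absurd (Finset.mem_univ _) hb

/-- ★ **THE SIZE OF `[h_□]D_U`** at a bi-contraction `U(b)`: `‖([h_□]D_U Λ)(b)‖ ≤ |c_f|·C1F∕(8S_j∕5)·‖Λ(chart b₊)‖` — print's «O(M⁻¹) … on a proper scale»
(`|c_f|·C1F∕(8S_j∕5) = (5∕8)C1F·|c_f|·L^{−j}∕(L·M_h)`, this seat's `C1F_div_bigSide_eq`). [cite: Balaban1985BackgroundPropagators, (3.100) p.413, p.414] -/
theorem norm_cutCommR_gradY_hTY_apply_le (c : ↥(cubes i.D.toDomains)) (U : CfgY 𝔸 i)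
    (hU : ∀ (μ : Fin (d + 1)) (x : Site (PV d ℓ i.m i.K hd hL) 0), ‖(U μ x : 𝔸)‖ ≤ 1 ∧ ‖(((U μ x)⁻¹ : 𝔸ˣ) : 𝔸)‖ ≤ 1)
    (Λ : SiteY i → 𝔸) (b : FBondY i) :
    ‖cutCommR (hBdY i (hTY i c)) (hTY i c) (gradY i U) Λ b‖ ≤ |i.cf| * (C1F d ℓ / (8 / 5 * (bigSide ℓ i.Mh c.1.1 : ℝ))) * ‖Λ (chartY i b.tgt)‖ := by
  rw [cutCommR_gradY_apply, norm_smul, Complex.norm_real, Real.norm_eq_abs, abs_mul]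
  have h1 : |hTY i c (chartY i b.src) - hTY i c (chartY i b.tgt)| ≤ C1F d ℓ / (8 / 5 * (bigSide ℓ i.Mh c.1.1 : ℝ)) := by
    rw [chart_tgt_eq_shiftY, abs_sub_comm]; exact abs_hTY_shiftY_sub_le i c b.dir _
  have h2 := B9Eq310Hermitian.norm_R_le (hU b.dir b.src).1 (hU b.dir b.src).2 (Λ (chartY i b.tgt))
  calc |i.cf| * |hTY i c (chartY i b.src) - hTY i c (chartY i b.tgt)| * ‖R (U b.dir b.src) (Λ (chartY i b.tgt))‖
      ≤ |i.cf| * (C1F d ℓ / (8 / 5 * (bigSide ℓ i.Mh c.1.1 : ℝ))) * ‖Λ (chartY i b.tgt)‖ :=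
        mul_le_mul (mul_le_mul_of_nonneg_left h1 (abs_nonneg _)) h2 (norm_nonneg _) (mul_nonneg (abs_nonneg _)
          (div_nonneg (C1F_nonneg d ℓ) (by positivity)))

/-- ★ the size of the first-order term of `cdB_cutMulY_apply`: `‖∇_{U,μ}(h_□A)(b) − h_□(b₋)∇_{U,μ}A(b)‖ ≤ |c_f|·C1F∕(8S_j∕5)·‖A(⟨b₋+e_μ, ν⟩)‖`.
[cite: Balaban1985BackgroundPropagators, (3.100) p.413, p.414 («O(M⁻¹)»)] -/
theorem norm_cdB_cutMulY_sub_le (c : ↥(cubes i.D.toDomains)) (U : CfgY 𝔸 i)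
    (hU : ∀ (μ : Fin (d + 1)) (x : Site (PV d ℓ i.m i.K hd hL) 0), ‖(U μ x : 𝔸)‖ ≤ 1 ∧ ‖(((U μ x)⁻¹ : 𝔸ˣ) : 𝔸)‖ ≤ 1)
    (μ : Fin (d + 1)) (A : FBondY i → 𝔸) (b : FBondY i) :
    ‖cdB i U μ (cutMulY (hBdY i (hTY i c)) A) b - ((hBdY i (hTY i c) b : ℝ) : ℂ) • cdB i U μ A b‖
      ≤ |i.cf| * (C1F d ℓ / (8 / 5 * (bigSide ℓ i.Mh c.1.1 : ℝ))) * ‖A ⟨b.src.shift μ, b.dir⟩‖ := by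
  rw [cdB_cutMulY_apply, add_sub_cancel_left, norm_smul, Complex.norm_real, Real.norm_eq_abs, abs_mul]
  have h1 : |hTY i c (chartY i (b.src.shift μ)) - hTY i c (chartY i b.src)| ≤ C1F d ℓ / (8 / 5 * (bigSide ℓ i.Mh c.1.1 : ℝ)) := by
    rw [← shiftY_chartY]; exact abs_hTY_shiftY_sub_le i c μ _
  have h2 := B9Eq310Hermitian.norm_R_le (hU μ b.src).1 (hU μ b.src).2 (A ⟨b.src.shift μ, b.dir⟩)
  exact mul_le_mul (mul_le_mul_of_nonneg_left h1 (abs_nonneg _)) h2 (norm_nonneg _)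
    (mul_nonneg (abs_nonneg _) (div_nonneg (C1F_nonneg d ℓ) (by positivity)))

/-- ★ and of `cdsB_cutMulY_apply`: `‖∇*_{U,μ}(h_□A)(b) − h_□(b₋)∇*_{U,μ}A(b)‖ ≤ |c_f|·C1F∕(8S_j∕5)·‖A(⟨b₋−e_μ, ν⟩)‖`.
[cite: Balaban1985BackgroundPropagators, (3.100) p.413, (3.8) p.392] -/
theorem norm_cdsB_cutMulY_sub_le (c : ↥(cubes i.D.toDomains)) (U : CfgY 𝔸 i)
    (hU : ∀ (μ : Fin (d + 1)) (x : Site (PV d ℓ i.m i.K hd hL) 0), ‖(U μ x : 𝔸)‖ ≤ 1 ∧ ‖(((U μ x)⁻¹ : 𝔸ˣ) : 𝔸)‖ ≤ 1)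
    (μ : Fin (d + 1)) (A : FBondY i → 𝔸) (b : FBondY i) :
    ‖cdsB i U μ (cutMulY (hBdY i (hTY i c)) A) b - ((hBdY i (hTY i c) b : ℝ) : ℂ) • cdsB i U μ A b‖
      ≤ |i.cf| * (C1F d ℓ / (8 / 5 * (bigSide ℓ i.Mh c.1.1 : ℝ))) * ‖A ⟨b.src.unshift μ, b.dir⟩‖ := by
  rw [cdsB_cutMulY_apply, add_sub_cancel_left, norm_smul, Complex.norm_real, Real.norm_eq_abs, abs_mul]
  have h1 : |hTY i c (chartY i (b.src.unshift μ)) - hTY i c (chartY i b.src)| ≤ C1F d ℓ / (8 / 5 * (bigSide ℓ i.Mh c.1.1 : ℝ)) := by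
    rw [← shiftY_symm_chartY]; exact abs_hTY_shiftY_symm_sub_le i c μ _
  have h2 := B9Eq310Hermitian.norm_R_le (hU μ (b.src.unshift μ)).2 (by rw [inv_inv]; exact (hU μ (b.src.unshift μ)).1)
    (A ⟨b.src.unshift μ, b.dir⟩)
  exact mul_le_mul (mul_le_mul_of_nonneg_left h1 (abs_nonneg _)) h2 (norm_nonneg _)
    (mul_nonneg (abs_nonneg _) (div_nonneg (C1F_nonneg d ℓ) (by positivity)))

/-! ## §4 The generic sizes specialised to the curl and the block averaging -/

/-- ★ **THE SIZE OF `[h_□]` OF THE COVARIANT CURL** at bi-contraction transporters: `‖([h_□]D_U A)(p)‖ ≤ C1F∕(8S_j∕5)·B·Σ_b|∂(p,b)|` for `‖A‖ ≤ B` on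
the contour of `p`. [cite: Balaban1985BackgroundPropagators, (3.4) p.391, (3.100) p.413, p.414] -/
theorem norm_cutCommR_curlY_hTY_apply_le (c : ↥(cubes i.D.toDomains)) (U : CfgY 𝔸 i)
    (hT : ∀ (p : PlaqY i) (b : FBondY i), ‖(curlT i U p b : 𝔸)‖ ≤ 1 ∧ ‖(((curlT i U p b)⁻¹ : 𝔸ˣ) : 𝔸)‖ ≤ 1)
    (A : FBondY i → 𝔸) (p : PlaqY i) {B : ℝ} (hA : ∀ b, curlK i p b ≠ 0 → ‖A b‖ ≤ B) :
    ‖cutCommR (hPlY i (hTY i c)) (hBdY i (hTY i c)) (curlY i U) A p‖ ≤ C1F d ℓ / (8 / 5 * (bigSide ℓ i.Mh c.1.1 : ℝ)) * B * ∑ b, |curlK i p b| :=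
  norm_cutCommR_trLiftY_apply_le_of_bound _ _ _ hT A p (div_nonneg (C1F_nonneg d ℓ) (by positivity))
    (fun b hb => abs_hPlY_sub_hBdY_le_of_curlK_ne_zero i c hb) hA

/-- ★ **THE SIZE OF `[h_□]` OF THE BLOCK AVERAGING `Q′(U)`**: `‖([h_□]Q′ Λ)(s)‖ ≤ sLipT∕(L·M_h)·B·Σ_z|Q′(s,z)|` for `‖Λ‖ ≤ B` on the block `s`.
[cite: Balaban1985BackgroundPropagators, (3.21) p.394, (3.102) p.414] -/
theorem norm_cutCommR_QpY_hTY_apply_le (c : ↥(cubes i.D.toDomains)) (parS : SiteParY 𝔸 i) (U : CfgY 𝔸 i)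
    (hT : ∀ (s : BlkY i) (z : SiteY i), ‖(qpT i parS U s z : 𝔸)‖ ≤ 1 ∧ ‖(((qpT i parS U s z)⁻¹ : 𝔸ˣ) : 𝔸)‖ ≤ 1)
    (Λ : SiteY i → 𝔸) (s : BlkY i) {B : ℝ} (hΛ : ∀ z, qpK i s z ≠ 0 → ‖Λ z‖ ≤ B) :
    ‖cutCommR (hBkY i (hTY i c)) (hTY i c) (QpY i parS U) Λ s‖ ≤ sLipT d ℓ / (((ℓ : ℝ) + 1) * i.Mh) * B * ∑ z, |qpK i s z| := by
  obtain ⟨_, hMh, _, _⟩ := side_conditions i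
  have hM : (0 : ℝ) < i.Mh := by exact_mod_cast (lt_of_lt_of_le (by norm_num) hMh)
  exact norm_cutCommR_trLiftY_apply_le_of_bound _ _ _ hT Λ s (div_nonneg (sLipT_nonneg d ℓ) (by positivity))
    (fun z hz => abs_hBkY_sub_le_of_qpK_ne_zero i c hz) hΛ

/-- ★ **THE SIZE OF `[h_□]` OF THE BOND AVERAGING `Q(U)`** (print's `S_j(∂h)`): `‖([h_□]Q A)(c)‖ ≤ sLipT∕(L·M_h)·(L+3)·B·Σ_f|Q(c,f)|` for `‖A‖ ≤ B` on
the double block (and `Σ_f Q(c,f) = 1`, `Q ≥ 0`: p21's `sum_qwt_eq_one`). [cite: Balaban1985BackgroundPropagators, (3.102) p.414 («S_j(∂h)»)] -/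
theorem norm_cutCommR_QY_hTY_apply_le (c : ↥(cubes i.D.toDomains)) (parB : BondParY 𝔸 i) (U : CfgY 𝔸 i)
    (hT : ∀ (y : IBondY i) (f : FBondY i), ‖(qT i parB U y f : 𝔸)‖ ≤ 1 ∧ ‖(((qT i parB U y f)⁻¹ : 𝔸ˣ) : 𝔸)‖ ≤ 1)
    (A : FBondY i → 𝔸) (y : IBondY i) {B : ℝ} (hA : ∀ f, qK i y f ≠ 0 → ‖A f‖ ≤ B) :
    ‖cutCommR (hIbY i (hTY i c)) (hBdY i (hTY i c)) (QY i parB U) A y‖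
      ≤ sLipT d ℓ / (((ℓ : ℝ) + 1) * i.Mh) * (((ℓ : ℝ) + 1) + 3) * B * ∑ f, |qK i y f| := by
  obtain ⟨_, hMh, _, _⟩ := side_conditions i
  have hM : (0 : ℝ) < i.Mh := by exact_mod_cast (lt_of_lt_of_le (by norm_num) hMh)
  exact norm_cutCommR_trLiftY_apply_le_of_bound _ _ _ hT A y (mul_nonneg (div_nonneg (sLipT_nonneg d ℓ) (by positivity)) (by positivity))
    (fun f hf => abs_hIbY_sub_hBdY_le_of_qK_ne_zero i c hf) hA

end Literature.MathematicalPhysics.QuantumFieldTheory.Balaban1983to89.B9Eq3104CutoffCommutatorSizes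

end
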